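import Summits.KontsevichZagierPeriods.KontsevichZagierPeriods.Theorems.RootDecompZetaThreeFrontierWordRungTwoP9

/-! # `RootDecompZetaThreeFrontierWordRungTwoP10` — part 10/12 of the mechanical ≤270-line split of `RungTwo.stripped.lean`
(split by the decomp-kz census seat for landing; mathematics unchanged; part 10 continues part 9). -/

noncomputable section

namespace Summit.KontsevichZagierPeriods.RootDecompZetaThreeFrontier.WordLayer
open Set MeasureTheory MvPolynomial
open Literature.NumberTheory.Transcendental
open Summit.KontsevichZagierPeriods.KontsevichZagierPeriods.Theses.RootDecompZetaThreeFrontier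
  (HigherWeightDescent)
open Summit.KontsevichZagierPeriods.KontsevichZagierPeriods.Theses.LinRedNormalForm
  (DihedralNormalForm MzvKernelInKZ HoffmanSpanInKZ HoffmanIndependence)

section Necessity
open Literature.ModelTheory.ExponentialFields (IsSemialgebraic)
































/-! (private copy of `strictAnti_fin_one` — dedup.landed / split policy; origin part RootDecompZetaThreeFrontierWordRungTwoP1) -/
/-- Auxiliary step `strictAnti_fin_one`. [bookkeeping] -/
private theorem strictAnti_fin_one (y : Fin 1 → ℝ) : StrictAnti y := fun a b hab =>
  absurd hab (by rw [Subsingleton.elim a b]; exact lt_irrefl _)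

/-! (private copy of `mem_simplex_one_iff` — dedup.landed / split policy; origin part RootDecompZetaThreeFrontierWordRungTwoP1) -/
/-- Membership in `simplex_one_iff`, unfolded. [bookkeeping] -/
private theorem mem_simplex_one_iff (y : Fin 1 → ℝ) : y ∈ KZ.openOrderedSimplex 1 ↔ 0 < y 0 ∧ y 0 < 1 := by
  constructor
  · rintro ⟨h0, h1, -⟩
    exact ⟨h0 0, h1 0⟩
  · rintro ⟨h0, h1⟩
    refine ⟨fun i => ?_, fun i => ?_, strictAnti_fin_one y⟩
    · rw [Fin.fin_one_eq_zero i]; exact h0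
    · rw [Fin.fin_one_eq_zero i]; exact h1

/-! (private copy of `mem_simplex_two_iff` — dedup.landed / split policy; origin part RootDecompZetaThreeFrontierWordRungTwoP1) -/
/-- Membership in `simplex_two_iff`, unfolded. [bookkeeping] -/
private theorem mem_simplex_two_iff (z : Fin 2 → ℝ) :
    z ∈ KZ.openOrderedSimplex 2 ↔ 0 < z 1 ∧ z 1 < z 0 ∧ z 0 < 1 := by
  constructor
  · rintro ⟨h0, h1, ha⟩
    exact ⟨h0 1, ha (show (0 : Fin 2) < 1 by decide), h1 0⟩
  · rintro ⟨h1, h10, h0⟩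
    refine ⟨Fin.forall_fin_two.mpr ⟨h1.trans h10, h1⟩, Fin.forall_fin_two.mpr ⟨h0, h10.trans h0⟩,
      Fin.strictAnti_iff_succ_lt.mpr (Fin.forall_fin_one.mpr ?_)⟩
    simpa using h10

/-! (private copy of `measurableSet_simplex` — dedup.landed / split policy; origin part RootDecompZetaThreeFrontierWordRungTwoP4a) -/
/-- `simplex` is measurable. [bookkeeping] -/
private theorem measurableSet_simplex (k : ℕ) : MeasurableSet (KZ.openOrderedSimplex k) :=
  IsSemialgebraic.measurableSet_holds (KZ.isSemialgebraic_openOrderedSimplex k)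

/-! (private copy of `snoc_one_zero` — dedup.landed / split policy; origin part RootDecompZetaThreeFrontierWordRungTwoP4) -/
/-- Auxiliary step `snoc_one_zero`. [bookkeeping] -/
private theorem snoc_one_zero (x : Fin 1 → ℝ) (t : ℝ) : (Fin.snoc x t : Fin 2 → ℝ) 0 = x 0 := rfl

/-! (private copy of `snoc_one_one` — dedup.landed / split policy; origin part RootDecompZetaThreeFrontierWordRungTwoP4) -/
/-- Auxiliary step `snoc_one_one`. [bookkeeping] -/
private theorem snoc_one_one (x : Fin 1 → ℝ) (t : ℝ) : (Fin.snoc x t : Fin 2 → ℝ) 1 = t := rfl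

/-- Auxiliary step `image_shΦ`. [bookkeeping] -/
theorem image_shΦ : shΦ '' KZ.openOrderedSimplex 2 = KZ.openOrderedSimplex 2 := by
  ext u
  constructor
  · rintro ⟨z, hz, rfl⟩
    exact mem_simplex_two_shΦ hz
  · intro hu
    exact ⟨shΦ u, mem_simplex_two_shΦ hu, shΦ_shΦ u⟩

/-- `F` integrable on `Δ₂` ⟹ `F ∘ τ` integrable on `Δ₂` -/
theorem integrableOn_comp_shΦ {F : (Fin 2 → ℝ) → ℝ} (hF : IntegrableOn F (KZ.openOrderedSimplex 2)) :
    IntegrableOn (fun z => F (shΦ z)) (KZ.openOrderedSimplex 2) := by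
  have hm := measurableSet_simplex 2
  have key := (integrableOn_image_iff_integrableOn_abs_det_fderiv_smul (μ := volume) hm
    (fun x _ => (hasFDerivAt_shΦ x).hasFDerivWithinAt) (fun a _ b _ h => by
      have := congrArg shΦ h
      rwa [shΦ_shΦ, shΦ_shΦ] at this) (fun z => F (shΦ z))).2
    (hF.congr_fun (fun p _ => by simp [abs_det_shL, shΦ_shΦ]) hm)
  rwa [image_shΦ] at key

/-- the open unit square `(0,1)²` (coordinates `(s,t)`) -/
def Sq : Set (Fin 2 → ℝ) := {y | 0 < y 0 ∧ y 0 < 1 ∧ 0 < y 1 ∧ y 1 < 1}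

/-- Auxiliary step `isOpen_Sq`. [bookkeeping] -/
theorem isOpen_Sq : IsOpen Sq := by
  have h0 : Continuous fun y : Fin 2 → ℝ => y 0 := continuous_apply 0
  have h1 : Continuous fun y : Fin 2 → ℝ => y 1 := continuous_apply 1
  simp only [Sq, Set.setOf_and]
  exact (isOpen_lt continuous_const h0).inter ((isOpen_lt h0 continuous_const).inter
    ((isOpen_lt continuous_const h1).inter (isOpen_lt h1 continuous_const)))

/-- `Sq` is measurable. [bookkeeping] -/
theorem measurableSet_Sq : MeasurableSet Sq := isOpen_Sq.measurableSet

/-- the blow-up chart `Ψ(s,t) = (t, ts)` of `Δ₂` by the square -/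
def chΨ (y : Fin 2 → ℝ) : Fin 2 → ℝ := ![y 1, y 1 * y 0]

/-- Auxiliary step `chΨ_zero`. [bookkeeping] -/
theorem chΨ_zero (y : Fin 2 → ℝ) : chΨ y 0 = y 1 := by simp [chΨ]

/-- Auxiliary step `chΨ_one`. [bookkeeping] -/
theorem chΨ_one (y : Fin 2 → ℝ) : chΨ y 1 = y 1 * y 0 := by simp [chΨ]

/-- the coordinate projections of `ℝ²` as continuous linear maps -/
abbrev Pj2 (i : Fin 2) : (Fin 2 → ℝ) →L[ℝ] ℝ :=
  ContinuousLinearMap.proj (R := ℝ) (φ := fun _ : Fin 2 => ℝ) i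

/-- the rows of `DΨ(y)` -/
def chRow (y : Fin 2 → ℝ) : Fin 2 → ((Fin 2 → ℝ) →L[ℝ] ℝ) := ![Pj2 1, y 1 • Pj2 0 + y 0 • Pj2 1]

/-- `DΨ(y)` -/
def chL (y : Fin 2 → ℝ) : (Fin 2 → ℝ) →L[ℝ] (Fin 2 → ℝ) := ContinuousLinearMap.pi (chRow y)

/-- Auxiliary step `chL_apply_zero`. [bookkeeping] -/
theorem chL_apply_zero (y h : Fin 2 → ℝ) : chL y h 0 = h 1 := by simp [chL, chRow]

/-- Auxiliary step `chL_apply_one`. [bookkeeping] -/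
theorem chL_apply_one (y h : Fin 2 → ℝ) : chL y h 1 = y 1 * h 0 + y 0 * h 1 := by simp [chL, chRow]

/-- Auxiliary step `hasFDerivAt_chΨ`. [bookkeeping] -/
theorem hasFDerivAt_chΨ (y : Fin 2 → ℝ) : HasFDerivAt chΨ (chL y) y := by
  have h0 : HasFDerivAt (fun q : Fin 2 → ℝ => q 0) (Pj2 0) y := hasFDerivAt_apply (𝕜 := ℝ) 0 y
  have h1 : HasFDerivAt (fun q : Fin 2 → ℝ => q 1) (Pj2 1) y := hasFDerivAt_apply (𝕜 := ℝ) 1 y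
  have c1 : HasFDerivAt (fun q : Fin 2 → ℝ => q 1 * q 0) (y 1 • Pj2 0 + y 0 • Pj2 1) y := h1.mul h0
  have key : HasFDerivAt (fun q : Fin 2 → ℝ => fun i => (![q 1, q 1 * q 0] : Fin 2 → ℝ) i)
      (ContinuousLinearMap.pi (chRow y)) y := by
    refine hasFDerivAt_pi.2 fun i => ?_
    fin_cases i
    · simpa [chRow] using h1
    · simpa [chRow] using c1
  exact key

/-- the Jacobian matrix of `Ψ` -/
def chM (y : Fin 2 → ℝ) : Matrix (Fin 2) (Fin 2) ℝ := !![0, 1; y 1, y 0]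

/-- Auxiliary step `chL_eq_toLin'`. [bookkeeping] -/
theorem chL_eq_toLin' (y : Fin 2 → ℝ) :
    (chL y : (Fin 2 → ℝ) →ₗ[ℝ] (Fin 2 → ℝ)) = Matrix.toLin' (chM y) := by
  apply LinearMap.ext
  intro h
  rw [Matrix.toLin'_apply, ContinuousLinearMap.coe_coe]
  funext i
  fin_cases i
  · simp [chL_apply_zero, chM, Matrix.mulVec, dotProduct, Fin.sum_univ_two]
  · simp [chL_apply_one, chM, Matrix.mulVec, dotProduct, Fin.sum_univ_two]

/-- Auxiliary step `det_chL`. [bookkeeping] -/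
theorem det_chL (y : Fin 2 → ℝ) : (chL y).det = -y 1 := by
  show LinearMap.det (chL y : (Fin 2 → ℝ) →ₗ[ℝ] (Fin 2 → ℝ)) = _
  rw [chL_eq_toLin', LinearMap.det_toLin', chM, Matrix.det_fin_two]
  simp

/-- Auxiliary step `chΨ_mem`. [bookkeeping] -/
theorem chΨ_mem {y : Fin 2 → ℝ} (hy : y ∈ Sq) : chΨ y ∈ KZ.openOrderedSimplex 2 := by
  obtain ⟨h0, h01, h1, h11⟩ := hy
  rw [mem_simplex_two_iff, chΨ_zero, chΨ_one]
  exact ⟨mul_pos h1 h0, by nlinarith, h11⟩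

/-- Auxiliary step `injOn_chΨ`. [bookkeeping] -/
theorem injOn_chΨ : InjOn chΨ Sq := by
  intro y hy y' hy' h
  have e1 : y 1 = y' 1 := by
    have := congrFun h 0
    rwa [chΨ_zero, chΨ_zero] at this
  have e0 : y 0 = y' 0 := by
    have := congrFun h 1
    rw [chΨ_one, chΨ_one, ← e1] at this
    exact mul_left_cancel₀ hy.2.2.1.ne' this
  funext i
  fin_cases i
  · exact e0
  · exact e1

/-- Auxiliary step `image_chΨ`. [bookkeeping] -/
theorem image_chΨ : chΨ '' Sq = KZ.openOrderedSimplex 2 := by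
  ext t
  constructor
  · rintro ⟨y, hy, rfl⟩
    exact chΨ_mem hy
  · intro ht
    obtain ⟨h1, h10, h0⟩ := (mem_simplex_two_iff t).1 ht
    have ht0 : 0 < t 0 := h1.trans h10
    refine ⟨![t 1 / t 0, t 0], ?_, ?_⟩
    · simp only [Sq, mem_setOf_eq, Matrix.cons_val_zero, Matrix.cons_val_one]
      exact ⟨by positivity, by rwa [div_lt_one ht0], ht0, h0⟩
    · funext i
      fin_cases i
      · simp [chΨ_zero]
      · simp [chΨ_one]
        field_simp

/-- **the blow-up pull-back**: `F` integrable on `Δ₂` ⟹ `(s,t) ↦ t·F(t, ts)` integrable on the square -/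
theorem integrableOn_chart {F : (Fin 2 → ℝ) → ℝ} (hF : IntegrableOn F (KZ.openOrderedSimplex 2)) :
    IntegrableOn (fun y => y 1 * F (chΨ y)) Sq := by
  have key := (integrableOn_image_iff_integrableOn_abs_det_fderiv_smul (μ := volume) measurableSet_Sq
    (fun y _ => (hasFDerivAt_chΨ y).hasFDerivWithinAt) injOn_chΨ F).1 (by rw [image_chΨ]; exact hF)
  refine key.congr_fun (fun y hy => ?_) measurableSet_Sq
  show |(chL y).det| • F (chΨ y) = y 1 * F (chΨ y)
  rw [det_chL, abs_neg, abs_of_pos hy.2.2.1, smul_eq_mul]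

/-- Auxiliary step `snoc_section_Sq`. [bookkeeping] -/
theorem snoc_section_Sq {x : Fin 1 → ℝ} (hx : x ∈ KZ.openOrderedSimplex 1) :
    {t : ℝ | (Fin.snoc x t : Fin 2 → ℝ) ∈ Sq} = Ioo 0 1 := by
  obtain ⟨hx0, hx1⟩ := (mem_simplex_one_iff x).1 hx
  ext t
  simp only [mem_setOf_eq, Sq, snoc_one_zero, snoc_one_one, mem_Ioo]
  exact ⟨fun h => ⟨h.2.2.1, h.2.2.2⟩, fun h => ⟨hx0, hx1, h.1, h.2⟩⟩

/-! ### 21d  Corner orders forced by integrability -/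

/-- the corner lift of `P`: the monomial `c·t₀^{e₀}t₁^{e₁}` becomes `c·s^{e_i}·t^{e₀+e₁+1}` (`i = 1`: chart `Ψ` at `(0,0)`;
`i = 0`: chart `σ∘Ψ` at `(1,1)` applied to `P(1-t₀,1-t₁)`) -/
noncomputable def cornerLift (i : Fin 2) (P : MvPolynomial (Fin 2) ℚ) : MvPolynomial (Fin 2) ℚ :=
  ∑ e ∈ P.support, MvPolynomial.monomial (Finsupp.single 0 (e i) + Finsupp.single 1 (e 0 + e 1 + 1))
    (MvPolynomial.coeff e P)

/-- Auxiliary step `aeval_cornerLift`. [bookkeeping] -/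
theorem aeval_cornerLift (i : Fin 2) (P : MvPolynomial (Fin 2) ℚ) (y : Fin 2 → ℝ) :
    MvPolynomial.aeval y (cornerLift i P) =
      ∑ e ∈ P.support, ((MvPolynomial.coeff e P : ℚ) : ℝ) * (y 0 ^ (e i) * y 1 ^ (e 0 + e 1 + 1)) := by
  rw [cornerLift, map_sum]
  refine Finset.sum_congr rfl fun e _ => ?_
  rw [MvPolynomial.aeval_monomial, Finsupp.prod_pow, Fin.prod_univ_two]
  simp [eq_ratCast]

/-- Membership in `support_cornerLift`, unfolded. [bookkeeping] -/
theorem mem_support_cornerLift (i : Fin 2) (P : MvPolynomial (Fin 2) ℚ) {e : Fin 2 →₀ ℕ} (he : e ∈ P.support) :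
    Finsupp.single 0 (e i) + Finsupp.single 1 (e 0 + e 1 + 1) ∈ (cornerLift i P).support := by
  classical
  have hinj : ∀ e' : Fin 2 →₀ ℕ, Finsupp.single (0 : Fin 2) (e' i) + Finsupp.single 1 (e' 0 + e' 1 + 1) =
      Finsupp.single 0 (e i) + Finsupp.single 1 (e 0 + e 1 + 1) → e' = e := by
    intro e' h
    have h0 := DFunLike.congr_fun h 0
    have h1 := DFunLike.congr_fun h 1
    simp only [Finsupp.coe_add, Pi.add_apply, Finsupp.single_apply] at h0 h1
    ext j
    fin_cases j <;> fin_cases i <;> simp at h0 h1 ⊢ <;> omega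
  rw [MvPolynomial.mem_support_iff, cornerLift, MvPolynomial.coeff_sum,
    Finset.sum_eq_single e (fun e' _ hne => ?_) (fun hne => absurd he hne)]
  · rw [MvPolynomial.coeff_monomial]
    split_ifs with h'
    · exact MvPolynomial.mem_support_iff.1 he
    · exact absurd rfl h'
  · rw [MvPolynomial.coeff_monomial]
    split_ifs with h'
    · exact absurd (hinj e' h') hne
    · rfl

end Necessity
end Summit.KontsevichZagierPeriods.RootDecompZetaThreeFrontier.WordLayer
end
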